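import Summits.ResolutionOfSingularities.ResolutionOfSingularities.Theorems.EquisingularLiftEquisingularLiftNatConeChart
import Summits.ResolutionOfSingularities.ResolutionOfSingularities.Theorems.EquisingularLiftEquisingularLiftNatNoseTraceSaturation
import Literature.AlgebraicGeometry.Resolution.MvPolynomialKillVars
import HarnessLib

/-!
# [OURS · L1 W4.5(b) · EL♮(3) · door ν4, D7 brick HNODE, core P6] THE NOSE CHART THEOREM — strict transform of `(c_{i₀}, Φ₂(c) + Ψ₃(c))`

res-L1-w45b-stub-2 g17 (HNODE pen). `--supports stmt-ResolutionOfSingularities-20148 --as helper`, no claim, counted 0. OURS; NOT a statement of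
[Hironaka2017]; AI-written, weaker than expert review. EL♮(3) is NOT proved here; char-p resolution is NOT proved anywhere in this tree. DEF-FREE.

On the chart `B = R[I/cᵢ]` of the blow-up of `I = (c₁, …, c_r)` (`c` quasi-regular, `R/I` a domain), with `t = cᵢ/1`, `e′ = c_{i₀}/cᵢ` and
`g′ = Φ₂(c/cᵢ) + t·Ψ₃(c/cᵢ)` for forms `Φ₂`, `Ψ₃` of degrees `2`, `3` such that the reduced dehomogenised `Φ̄₂` is not divisible by `T_{i₀}`:
* `algebraMap_nose_eq` — `(c_{i₀}, Φ₂(c) + Ψ₃(c))·B = (t e′, t² g′)`;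
* `frac_saturated` — `(e′)` is `t`-saturated (tree `mem_span_coneTransform_of_algebraMap_mul_mem` for the linear form `T_{i₀}`);
* `isPrime_span_pair_and_notMem` — for `i₀ ≠ i`, `(e′, t)` is a prime of `B` (quotient `(R/I)[T_{j ≠ i, i₀}]`) not containing `g′`;
* ★ `iSup_colon_nose_eq_span_localization` — in every localisation `S` of `B` at a prime containing `t`:
  `⋃ₙ ((t e′, t² g′) : tⁿ) = (e′, g′)` — the stalk shape of the strict transform of the NOSE MODEL `(c_{i₀}, g)` (host equation `c_{i₀}`, node `g`).
-/

set_option linter.dupNamespace false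

noncomputable section

namespace Summit.ResolutionOfSingularities.ResolutionOfSingularities.Cruxes.EquisingularLiftNat.Sections.Equinodal

open MvPolynomial IsLocalization Literature.AlgebraicGeometry.Resolution
open Summit.ResolutionOfSingularities.ResolutionOfSingularities.Cruxes.EquisingularLiftNat.Sections

namespace NoseChart

universe u

variable {R : Type u} [CommRing R] {r : ℕ} (c : Fin r → R) (i i₀ : Fin r)

/-- `(c_{i₀}, Φ₂(c) + Ψ₃(c)) · R[I/cᵢ] = (t e′, t² g′)` with `g′ = Φ₂(c/cᵢ) + t Ψ₃(c/cᵢ)`. [folklore] -/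
theorem algebraMap_nose_eq {Φ₂ Ψ₃ : MvPolynomial (Fin r) R} (hΦ₂ : Φ₂.IsHomogeneous 2) (hΨ₃ : Ψ₃.IsHomogeneous 3) :
    algebraMap R (blowupAlgebra (Ideal.span (Set.range c)) (c i)) (c i₀) =
        algebraMap R (blowupAlgebra (Ideal.span (Set.range c)) (c i)) (c i) * blowupAlgebra.frac c i i₀ ∧
      algebraMap R (blowupAlgebra (Ideal.span (Set.range c)) (c i)) (MvPolynomial.eval c Φ₂ + MvPolynomial.eval c Ψ₃) =
        algebraMap R (blowupAlgebra (Ideal.span (Set.range c)) (c i)) (c i) ^ 2 *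
          (MvPolynomial.aeval (blowupAlgebra.frac c i) Φ₂ +
            algebraMap R (blowupAlgebra (Ideal.span (Set.range c)) (c i)) (c i) * MvPolynomial.aeval (blowupAlgebra.frac c i) Ψ₃) := by
  refine ⟨(blowupAlgebra.algebraMap_mul_gen _ _ _ _).symm, ?_⟩
  rw [map_add, algebraMap_eval_eq_pow_mul_coneTransform c i hΦ₂, algebraMap_eval_eq_pow_mul_coneTransform c i hΨ₃]
  ring

variable [IsDomain (R ⧸ Ideal.span (Set.range c))]

/-- `(e′)` is `t`-saturated in `R[I/cᵢ]` (`e′ = c_{i₀}/cᵢ` is the cone transform of the linear form `T_{i₀}`). [folklore] -/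
theorem frac_saturated (hc : IsQuasiRegular c) (y : blowupAlgebra (Ideal.span (Set.range c)) (c i))
    (hy : algebraMap R (blowupAlgebra (Ideal.span (Set.range c)) (c i)) (c i) * y ∈ Ideal.span {blowupAlgebra.frac c i i₀}) :
    y ∈ Ideal.span {blowupAlgebra.frac c i i₀} := by
  classical
  have hX : MvPolynomial.aeval (blowupAlgebra.frac c i) (MvPolynomial.X i₀ : MvPolynomial (Fin r) R) = blowupAlgebra.frac c i i₀ :=
    MvPolynomial.aeval_X _ _
  have hne : MvPolynomial.map (Ideal.Quotient.mk (Ideal.span (Set.range c))) (dehomogenize i (MvPolynomial.X i₀ : MvPolynomial (Fin r) R)) ≠ 0 := by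
    change MvPolynomial.map _ (MvPolynomial.aeval (killVar i) (MvPolynomial.X i₀)) ≠ 0
    rw [MvPolynomial.aeval_X]
    by_cases h : i₀ = i
    · subst h; rw [killVar_self, map_one]; exact one_ne_zero
    · rw [killVar_of_ne i h, MvPolynomial.map_X]; exact MvPolynomial.X_ne_zero _
  have h := mem_span_coneTransform_of_algebraMap_mul_mem c i hc hne y (by rwa [hX])
  rwa [hX] at h

set_option synthInstance.maxHeartbeats 80000 in
/-- For `i₀ ≠ i`: `(e′, t) ⊂ R[I/cᵢ]` is the kernel of `B → B/(t) ≅ (R/I)[T_{j≠i}] → (R/I)[T_{j≠i}]/(T_{i₀})`, hence prime, and it does not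
contain `g′` when `Φ̄₂ ∉ (T_{i₀})`. [cite: StacksProject, Tag 0BIQ] -/
theorem isPrime_span_pair_and_notMem (hc : IsQuasiRegular c) (hne : i₀ ≠ i) {Φ₂ Ψ₃ : MvPolynomial (Fin r) R}
    (hΦ₀ : MvPolynomial.map (Ideal.Quotient.mk (Ideal.span (Set.range c))) (dehomogenize i Φ₂) ∉
      Ideal.span (MvPolynomial.X '' ({⟨i₀, hne⟩} : Set {j : Fin r // j ≠ i}))) :
    (Ideal.span {blowupAlgebra.frac c i i₀, algebraMap R (blowupAlgebra (Ideal.span (Set.range c)) (c i)) (c i)}).IsPrime ∧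
      MvPolynomial.aeval (blowupAlgebra.frac c i) Φ₂ +
          algebraMap R (blowupAlgebra (Ideal.span (Set.range c)) (c i)) (c i) * MvPolynomial.aeval (blowupAlgebra.frac c i) Ψ₃ ∉
        Ideal.span {blowupAlgebra.frac c i i₀, algebraMap R (blowupAlgebra (Ideal.span (Set.range c)) (c i)) (c i)} := by
  classical
  -- the composite `π₂ : B → B/(t) ≅ (R/I)[T_{j≠i}] → (R/I)[T_{j≠i}]/(T_{i₀})`
  let π₂ := ((Ideal.Quotient.mk (Ideal.span (MvPolynomial.X '' ({⟨i₀, hne⟩} : Set {j : Fin r // j ≠ i})) : Ideal (MvPolynomial {j : Fin r // j ≠ i} (R ⧸ Ideal.span (Set.range c))))).comp (blowupAlgebraQuotEquiv c i hc).symm.toRingHom).comp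
    (Ideal.Quotient.mk (Ideal.span {algebraMap R (blowupAlgebra (Ideal.span (Set.range c)) (c i)) (c i)}))
  have hψe : (blowupAlgebraQuotEquiv c i hc).symm ((Ideal.Quotient.mk (Ideal.span {algebraMap R (blowupAlgebra (Ideal.span (Set.range c)) (c i)) (c i)})) (blowupAlgebra.frac c i i₀)) = MvPolynomial.X ⟨i₀, hne⟩ := by
    rw [RingEquiv.symm_apply_eq, blowupAlgebraQuotEquiv_X]
  have hsurj_t : Function.Surjective (Ideal.Quotient.mk (Ideal.span {algebraMap R (blowupAlgebra (Ideal.span (Set.range c)) (c i)) (c i)})) := Ideal.Quotient.mk_surjective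
  -- kernel of `π₂` is `(e′, t)`
  have h1 : (Ideal.span (MvPolynomial.X '' ({⟨i₀, hne⟩} : Set {j : Fin r // j ≠ i})) : Ideal (MvPolynomial {j : Fin r // j ≠ i} (R ⧸ Ideal.span (Set.range c)))).comap (blowupAlgebraQuotEquiv c i hc).symm.toRingHom = Ideal.span {(Ideal.Quotient.mk (Ideal.span {algebraMap R (blowupAlgebra (Ideal.span (Set.range c)) (c i)) (c i)})) (blowupAlgebra.frac c i i₀)} := by
    rw [Set.image_singleton]
    ext z
    rw [Ideal.mem_comap, Ideal.mem_span_singleton]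
    constructor
    · rintro ⟨w, hw⟩
      have hz : z = (blowupAlgebraQuotEquiv c i hc) w * (Ideal.Quotient.mk (Ideal.span {algebraMap R (blowupAlgebra (Ideal.span (Set.range c)) (c i)) (c i)})) (blowupAlgebra.frac c i i₀) :=
        (blowupAlgebraQuotEquiv c i hc).symm.injective (by rw [map_mul, hψe, RingEquiv.symm_apply_apply, mul_comm]; exact hw)
      rw [hz]; exact Ideal.mul_mem_left _ _ (Ideal.mem_span_singleton_self _)
    · intro hz
      obtain ⟨a, ha⟩ := Submodule.mem_span_singleton.mp hz
      refine ⟨(blowupAlgebraQuotEquiv c i hc).symm a, ?_⟩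
      change (blowupAlgebraQuotEquiv c i hc).symm z = _
      rw [← ha, smul_eq_mul, map_mul, hψe, mul_comm]
  have hker : RingHom.ker π₂ =
      Ideal.span {blowupAlgebra.frac c i i₀, algebraMap R (blowupAlgebra (Ideal.span (Set.range c)) (c i)) (c i)} := by
    change RingHom.ker (((Ideal.Quotient.mk (Ideal.span (MvPolynomial.X '' ({⟨i₀, hne⟩} : Set {j : Fin r // j ≠ i})) : Ideal (MvPolynomial {j : Fin r // j ≠ i} (R ⧸ Ideal.span (Set.range c))))).comp (blowupAlgebraQuotEquiv c i hc).symm.toRingHom).comp (Ideal.Quotient.mk (Ideal.span {algebraMap R (blowupAlgebra (Ideal.span (Set.range c)) (c i)) (c i)}))) = _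
    rw [← RingHom.comap_ker, ← RingHom.comap_ker, Ideal.mk_ker, h1]
    have h2 : Ideal.span {(Ideal.Quotient.mk (Ideal.span {algebraMap R (blowupAlgebra (Ideal.span (Set.range c)) (c i)) (c i)})) (blowupAlgebra.frac c i i₀)} = (Ideal.span {blowupAlgebra.frac c i i₀}).map (Ideal.Quotient.mk (Ideal.span {algebraMap R (blowupAlgebra (Ideal.span (Set.range c)) (c i)) (c i)})) := by
      rw [Ideal.map_span, Set.image_singleton]
    rw [h2, Ideal.comap_map_of_surjective _ hsurj_t, ← RingHom.ker_eq_comap_bot]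
    change _ ⊔ RingHom.ker (Ideal.Quotient.mk _) = _
    rw [Ideal.mk_ker, Ideal.span_insert]
  haveI : IsDomain (MvPolynomial {j : Fin r // j ≠ i} (R ⧸ Ideal.span (Set.range c)) ⧸ (Ideal.span (MvPolynomial.X '' ({⟨i₀, hne⟩} : Set {j : Fin r // j ≠ i})) : Ideal (MvPolynomial {j : Fin r // j ≠ i} (R ⧸ Ideal.span (Set.range c))))) := Literature.AlgebraicGeometry.Resolution.MvPolynomial.isDomain_quotient_span_X _
  refine ⟨?_, ?_⟩
  · rw [← hker]; exact RingHom.ker_isPrime π₂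
  · rw [← hker, RingHom.mem_ker]
    have ht0 : (Ideal.Quotient.mk (Ideal.span {algebraMap R (blowupAlgebra (Ideal.span (Set.range c)) (c i)) (c i)})) (algebraMap R (blowupAlgebra (Ideal.span (Set.range c)) (c i)) (c i)) = 0 :=
      Ideal.Quotient.eq_zero_iff_mem.mpr (Ideal.mem_span_singleton_self _)
    have hval : π₂ (MvPolynomial.aeval (blowupAlgebra.frac c i) Φ₂ +
        algebraMap R (blowupAlgebra (Ideal.span (Set.range c)) (c i)) (c i) * MvPolynomial.aeval (blowupAlgebra.frac c i) Ψ₃) =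
        Ideal.Quotient.mk (Ideal.span (MvPolynomial.X '' ({⟨i₀, hne⟩} : Set {j : Fin r // j ≠ i})) : Ideal (MvPolynomial {j : Fin r // j ≠ i} (R ⧸ Ideal.span (Set.range c)))) (MvPolynomial.map (Ideal.Quotient.mk (Ideal.span (Set.range c))) (dehomogenize i Φ₂)) := by
      change Ideal.Quotient.mk (Ideal.span (MvPolynomial.X '' ({⟨i₀, hne⟩} : Set {j : Fin r // j ≠ i})) : Ideal (MvPolynomial {j : Fin r // j ≠ i} (R ⧸ Ideal.span (Set.range c)))) ((blowupAlgebraQuotEquiv c i hc).symm ((Ideal.Quotient.mk (Ideal.span {algebraMap R (blowupAlgebra (Ideal.span (Set.range c)) (c i)) (c i)})) _)) = _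
      rw [map_add, map_mul, ht0, zero_mul, add_zero]
      change Ideal.Quotient.mk (Ideal.span (MvPolynomial.X '' ({⟨i₀, hne⟩} : Set {j : Fin r // j ≠ i})) : Ideal (MvPolynomial {j : Fin r // j ≠ i} (R ⧸ Ideal.span (Set.range c)))) ((blowupAlgebraQuotEquiv c i hc).symm (Ideal.Quotient.mk _ _)) = _
      rw [mk_coneTransform_eq c i hc Φ₂, RingEquiv.symm_apply_apply]
    rw [hval, Ideal.Quotient.eq_zero_iff_mem]
    exact hΦ₀

set_option synthInstance.maxHeartbeats 80000 in
/-- ★ **THE NOSE CHART THEOREM.** In every localisation `S` of `B = R[I/cᵢ]` at a prime `𝔔 ∋ t` (`c` quasi-regular, `R/I` a domain, `Φ̄₂ ∉ (T_{i₀})` for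
`i₀ ≠ i`): the `t`-saturation of `(t e′, t² g′) = (c_{i₀}, Φ₂(c) + Ψ₃(c))·S` is `(e′, g′)`, `e′ = c_{i₀}/cᵢ`, `g′ = Φ₂(c/cᵢ) + t Ψ₃(c/cᵢ)`.
This is the stalk of the strict transform of the NOSE MODEL through the section blow-up. [cite: StacksProject, Tag 0BIQ] [cite: GortzWedhorn2020, (13.19)] -/
theorem iSup_colon_nose_eq_span_localization (hc : IsQuasiRegular c) {Φ₂ Ψ₃ : MvPolynomial (Fin r) R}
    (hΦ₂ : Φ₂.IsHomogeneous 2) (hΨ₃ : Ψ₃.IsHomogeneous 3)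
    (hΦ₀ : ∀ hne : i₀ ≠ i, MvPolynomial.map (Ideal.Quotient.mk (Ideal.span (Set.range c))) (dehomogenize i Φ₂) ∉
      Ideal.span (MvPolynomial.X '' ({⟨i₀, hne⟩} : Set {j : Fin r // j ≠ i})))
    (𝔔 : Ideal (blowupAlgebra (Ideal.span (Set.range c)) (c i))) [𝔔.IsPrime]
    (ht𝔔 : algebraMap R (blowupAlgebra (Ideal.span (Set.range c)) (c i)) (c i) ∈ 𝔔)
    (S : Type u) [CommRing S] [Algebra (blowupAlgebra (Ideal.span (Set.range c)) (c i)) S] [IsLocalization.AtPrime S 𝔔] :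
    (⨆ n : ℕ, Submodule.colon
        (Ideal.span {algebraMap (blowupAlgebra (Ideal.span (Set.range c)) (c i)) S
            (algebraMap R (blowupAlgebra (Ideal.span (Set.range c)) (c i)) (c i₀)),
          algebraMap (blowupAlgebra (Ideal.span (Set.range c)) (c i)) S
            (algebraMap R (blowupAlgebra (Ideal.span (Set.range c)) (c i)) (MvPolynomial.eval c Φ₂ + MvPolynomial.eval c Ψ₃))})
        ((Ideal.span {algebraMap (blowupAlgebra (Ideal.span (Set.range c)) (c i)) S
            (algebraMap R (blowupAlgebra (Ideal.span (Set.range c)) (c i)) (c i))} ^ n : Ideal S) : Set S)) =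
      Ideal.span {algebraMap (blowupAlgebra (Ideal.span (Set.range c)) (c i)) S (blowupAlgebra.frac c i i₀),
        algebraMap (blowupAlgebra (Ideal.span (Set.range c)) (c i)) S
          (MvPolynomial.aeval (blowupAlgebra.frac c i) Φ₂ +
            algebraMap R (blowupAlgebra (Ideal.span (Set.range c)) (c i)) (c i) * MvPolynomial.aeval (blowupAlgebra.frac c i) Ψ₃)} := by
  classical
  obtain ⟨he, hg⟩ := algebraMap_nose_eq c i i₀ hΦ₂ hΨ₃
  -- names in `S`
  haveI : IsLocalRing S := IsLocalization.AtPrime.isLocalRing S 𝔔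
  refine NoseTrace.iSup_colon_span_singleton_pow_eq _ _ _ ?_ ?_ _ ?_
  · -- (e′) is t-saturated in S
    intro z hz
    exact mem_span_algebraMap_of_mul_mem_localization 𝔔.primeCompl S (frac_saturated c i i₀ hc) z hz
  · -- g′ is a nonzerodivisor modulo (e′, t) in S
    intro a ha
    by_cases hne : i₀ = i
    · have h1 : blowupAlgebra.frac c i i₀ = 1 := by cases hne; exact blowupAlgebra.gen_self _ _ _
      have htop : Ideal.span {algebraMap (blowupAlgebra (Ideal.span (Set.range c)) (c i)) S (blowupAlgebra.frac c i i₀),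
          algebraMap (blowupAlgebra (Ideal.span (Set.range c)) (c i)) S
            (algebraMap R (blowupAlgebra (Ideal.span (Set.range c)) (c i)) (c i))} = ⊤ := by
        refine Ideal.eq_top_of_isUnit_mem _ (Ideal.subset_span (Set.mem_insert _ _)) ?_
        rw [h1, map_one]; exact isUnit_one
      rw [htop]; exact Submodule.mem_top
    · obtain ⟨hprime, hnot⟩ := isPrime_span_pair_and_notMem c i i₀ hc hne (hΦ₀ hne)
      by_cases he𝔔 : blowupAlgebra.frac c i i₀ ∈ 𝔔
      · -- the prime (e′, t) lies in 𝔔: it extends to a prime of S not containing g′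
        have hle : Ideal.span {blowupAlgebra.frac c i i₀, algebraMap R (blowupAlgebra (Ideal.span (Set.range c)) (c i)) (c i)} ≤ 𝔔 := by
          rw [Ideal.span_le]; rintro y (rfl | hy)
          · exact he𝔔
          · rw [Set.mem_singleton_iff] at hy; subst hy; exact ht𝔔
        have hdisj : Disjoint (𝔔.primeCompl : Set (blowupAlgebra (Ideal.span (Set.range c)) (c i)))
            ((Ideal.span {blowupAlgebra.frac c i i₀, algebraMap R (blowupAlgebra (Ideal.span (Set.range c)) (c i)) (c i)} :
              Ideal (blowupAlgebra (Ideal.span (Set.range c)) (c i))) : Set (blowupAlgebra (Ideal.span (Set.range c)) (c i))) :=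
          Set.disjoint_left.mpr fun y hy hy' => hy (hle hy')
        haveI hP : (Ideal.map (algebraMap _ S)
            (Ideal.span {blowupAlgebra.frac c i i₀, algebraMap R (blowupAlgebra (Ideal.span (Set.range c)) (c i)) (c i)})).IsPrime :=
          IsLocalization.isPrime_of_isPrime_disjoint 𝔔.primeCompl S _ hprime hdisj
        have hmap : Ideal.map (algebraMap _ S)
            (Ideal.span {blowupAlgebra.frac c i i₀, algebraMap R (blowupAlgebra (Ideal.span (Set.range c)) (c i)) (c i)}) =
            Ideal.span {algebraMap (blowupAlgebra (Ideal.span (Set.range c)) (c i)) S (blowupAlgebra.frac c i i₀),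
              algebraMap (blowupAlgebra (Ideal.span (Set.range c)) (c i)) S
                (algebraMap R (blowupAlgebra (Ideal.span (Set.range c)) (c i)) (c i))} := by
          rw [Ideal.map_span, Set.image_pair]
        have hnot' : algebraMap (blowupAlgebra (Ideal.span (Set.range c)) (c i)) S
            (MvPolynomial.aeval (blowupAlgebra.frac c i) Φ₂ +
              algebraMap R (blowupAlgebra (Ideal.span (Set.range c)) (c i)) (c i) * MvPolynomial.aeval (blowupAlgebra.frac c i) Ψ₃) ∉
            Ideal.span {algebraMap (blowupAlgebra (Ideal.span (Set.range c)) (c i)) S (blowupAlgebra.frac c i i₀),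
              algebraMap (blowupAlgebra (Ideal.span (Set.range c)) (c i)) S
                (algebraMap R (blowupAlgebra (Ideal.span (Set.range c)) (c i)) (c i))} := by
          rw [← hmap]
          intro hmem
          apply hnot
          have h := IsLocalization.under_map_of_isPrime_disjoint 𝔔.primeCompl S hprime hdisj
          have h' : _ ∈ (Ideal.map (algebraMap _ S)
              (Ideal.span {blowupAlgebra.frac c i i₀, algebraMap R (blowupAlgebra (Ideal.span (Set.range c)) (c i)) (c i)})).under _ :=
            Ideal.mem_comap.mpr hmem
          rwa [h] at h'
        haveI : IsDomain (S ⧸ Ideal.span {algebraMap (blowupAlgebra (Ideal.span (Set.range c)) (c i)) S (blowupAlgebra.frac c i i₀),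
              algebraMap (blowupAlgebra (Ideal.span (Set.range c)) (c i)) S
                (algebraMap R (blowupAlgebra (Ideal.span (Set.range c)) (c i)) (c i))}) := by
          rw [hmap] at hP; exact (Ideal.Quotient.isDomain_iff_prime _).mpr hP
        exact NoseTrace.mul_mem_span_pair_imp_of_isDomain_quotient _ _ _
          (fun h0 => hnot' ((Ideal.Quotient.eq_zero_iff_mem).mp h0)) a ha
      · -- e′ is a unit in S
        have hu : IsUnit (algebraMap (blowupAlgebra (Ideal.span (Set.range c)) (c i)) S (blowupAlgebra.frac c i i₀)) :=
          IsLocalization.map_units S (⟨blowupAlgebra.frac c i i₀, he𝔔⟩ : 𝔔.primeCompl)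
        have htop : Ideal.span {algebraMap (blowupAlgebra (Ideal.span (Set.range c)) (c i)) S (blowupAlgebra.frac c i i₀),
              algebraMap (blowupAlgebra (Ideal.span (Set.range c)) (c i)) S
                (algebraMap R (blowupAlgebra (Ideal.span (Set.range c)) (c i)) (c i))} = ⊤ :=
          Ideal.eq_top_of_isUnit_mem _ (Ideal.subset_span (Set.mem_insert _ _)) hu
        rw [htop]; exact Submodule.mem_top
  · rw [he, hg, map_mul, map_mul, map_pow]

end NoseChart


end Summit.ResolutionOfSingularities.ResolutionOfSingularities.Cruxes.EquisingularLiftNat.Sections.Equinodal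

end
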